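import Summits.ValiantsHypothesis.ValiantsHypothesis.Theorems.BarrierLeverAnchoredDoorHitsLowerPairsUQFaceCore
import Summits.ValiantsHypothesis.ValiantsHypothesis.Theorems.BarrierLeverAnchoredDoorHitsLowerPairsUQFaceStep

/-!
# Support item `AnchoredDoorHitsLowerPairs` (stmt-ValiantsHypothesis-22510), line `anchored-peeling`:
# THE REGISTERED STUB `Stmt.stub_uqFaceStep` IS A KERNEL THEOREM (module 3/3: assembly by name)

Prover file (`--supports stmt-ValiantsHypothesis-22510`; cell valiant-natproofs, rung V4, 𝒟-side door (c); registered line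
`Cruxes/AnchoredDoorHitsLowerPairs/Lines/anchored_peeling.lean` v13, composition `AnchoredDoorHitsLowerPairs_of : Stmt.stub_uqFaceStep →
Stmt.stub_uqFaceResidual → AnchoredDoorHitsLowerPairs`; prover seat val-np-p1 gen 20). Proves the registered stub `Stmt.stub_uqFaceStep` (statement
restated verbatim in `…UQFaceStep`, p614490) from the core theorem `symbolicDet_ne_zero_of_uqFaceCore` (`…UQFaceCore`): from face-UQ data
`UQFData s u w a W₀ 𝒜 ρ` it builds the reindexings (deletion rows = kept ⊕ `κ`, `κ` = the rows whose face lies in the up-set `𝒜`; `W₀`-columns = kept ⊕ `κ`,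
the KEPT link columns being the `ℓ_a` columns through `W₀` with the SMALLEST faces — so that their faces minus `W₀` form a lower family — and the deleted
ones matched with `κ` by counting, `ℓ_a + |𝒜| = ℓ_{W₀}`), and feeds the two hypotheses of the stub (symbolic minors of enumerations of the reduced
deletion pair and of lower sub-pairs of the link pair) as the minors (H1), (H2).

* `exists_subset_card_eq_minimal` — `k` elements of a finset minimising a weight (the kept link columns).
* `stub_uqFaceStep : Stmt.stub_uqFaceStep` — **the registered stub, by name.** With it the line's skeleton reduces the support item
  `AnchoredDoorHitsLowerPairs` to the single residual stub `Stmt.stub_uqFaceResidual` (pairs with no face-UQ data on either side; census-empty on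
  everything enumerated, first theoretical members at `s = 2` around `r ≥ 2048`).

WHAT THIS IS NOT: no claim on `Stmt.stub_uqFaceResidual`; the item stays open; nothing on crux stmt-ValiantsHypothesis-14610 or on `VP` versus `VNP`.
-/

set_option linter.dupNamespace false

open Matrix

namespace Summit.ValiantsHypothesis.ValiantsHypothesis.Theorems.BarrierLever.AnchoredPeeling

open Finset MvPolynomial
open Summit.ValiantsHypothesis.ValiantsHypothesis.Theorems.BarrierLever.BrickCalculus (pexpo pexpo_def pexpo_le_iff pexpo_sub)

noncomputable section

/-! ## 1. Choosing the kept link columns -/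

/-- `k ≤ |s|` elements of `s` minimising `f`: a subset `t` of size `k` with `f x ≤ f y` for all `x ∈ t`, `y ∈ s ∖ t`. -/
theorem exists_subset_card_eq_minimal {ι : Type*} [DecidableEq ι] (s : Finset ι) (f : ι → ℕ) :
    ∀ k : ℕ, k ≤ s.card → ∃ t ⊆ s, t.card = k ∧ ∀ x ∈ t, ∀ y ∈ s, y ∉ t → f x ≤ f y := by
  intro k
  induction k with
  | zero => exact fun _ => ⟨∅, Finset.empty_subset _, Finset.card_empty, fun x hx => absurd hx (Finset.notMem_empty x)⟩
  | succ k ih =>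
    intro hk
    obtain ⟨t, hts, htk, hmin⟩ := ih (Nat.le_of_succ_le hk)
    have hne : (s \ t).Nonempty := by
      rw [← Finset.card_pos, Finset.card_sdiff_of_subset hts, htk]
      omega
    obtain ⟨y₀, hy₀, hy₀min⟩ := Finset.exists_min_image (s \ t) f hne
    rw [Finset.mem_sdiff] at hy₀
    refine ⟨insert y₀ t, Finset.insert_subset hy₀.1 hts, by rw [Finset.card_insert_of_notMem hy₀.2, htk], ?_⟩
    intro x hx y hy hyt
    rw [Finset.mem_insert] at hx
    have hyt' : y ∉ t := fun h' => hyt (Finset.mem_insert_of_mem h')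
    have hyne : y ≠ y₀ := fun h' => hyt (h' ▸ Finset.mem_insert_self y₀ t)
    rcases hx with rfl | hx
    · exact hy₀min y (Finset.mem_sdiff.mpr ⟨hy, hyt'⟩)
    · exact hmin x hx y hy hyt'

/-! ## 2. The registered stub -/

/-- **THE FACE-TARGET UQ_s-STEP (registered stub `Stmt.stub_uqFaceStep`, by name).** For an injective simplicial-complex pair `(R, C)` at profile `s ≥ 1`,
face-UQ data at `(a, W₀)` — an up-set `𝒜 ⊆ del_a R` with `ℓ_a + |𝒜| = ℓ_{W₀}` and distinct roots of size `≤ s` — together with the symbolic non-vanishing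
of the reduced deletion pair `(del_a R ∖ 𝒜, C ∖ st W₀)` and of the lower sub-pairs of the link pair `(lk_a R, lk_C W₀)` forces `symbolicDet s h r u w ≠ 0`. -/
theorem stub_uqFaceStep : Stmt.stub_uqFaceStep := by
  classical
  intro s h r u w hs hu hw hlu hlw a W₀ 𝒜 ρ hD Hdel Hlink
  obtain ⟨-, -, hW1, hWs, h𝒜, hup, hcard, hρ, hρinj⟩ := hD
  -- the target face as `insert c D`
  obtain ⟨c, hc⟩ := Finset.card_pos.mp hW1
  have hFD : insert c (W₀.erase c) = W₀ := Finset.insert_erase hc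
  -- (1) deletion rows: kept ⊕ κ
  let X := {i : Fin r // ¬ (a ∈ u i)}
  let Pk : X → Prop := fun x => u x.1 ∉ 𝒜
  let κ := {x : X // ¬ Pk x}
  let n : ℕ := Fintype.card {x : X // Pk x}
  let eFin : {x : X // Pk x} ≃ Fin n := Fintype.equivFinOfCardEq rfl
  let e : X ≃ Fin n ⊕ κ := (Equiv.sumCompl Pk).symm.trans (Equiv.sumCongr eFin (Equiv.refl κ))
  have he_inr : ∀ k : κ, e.symm (Sum.inr k) = k.1 := fun k => by
    simp [e, Equiv.sumCongr_symm, Equiv.sumCongr_apply]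
    rfl
  have he_inl : ∀ x : Fin n, e.symm (Sum.inl x) = (eFin.symm x).1 := fun x => by
    simp [e, Equiv.sumCongr_symm, Equiv.sumCongr_apply]
  have hκmem : ∀ k : κ, u k.1.1 ∈ 𝒜 := fun k => not_not.mp k.2
  -- (2) cardinalities
  let ℓa : ℕ := Fintype.card {i : Fin r // a ∈ u i}
  have hℓa : ℓa = (Finset.univ.filter (fun i => a ∈ u i)).card := Fintype.card_subtype _
  have hℓW : Fintype.card {j : Fin r // W₀ ⊆ w j} = (Finset.univ.filter (fun j => W₀ ⊆ w j)).card := Fintype.card_subtype _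
  have hℓa_le : ℓa ≤ r := (Fintype.card_subtype_le _).trans (by rw [Fintype.card_fin])
  have hℓW_le : Fintype.card {j : Fin r // W₀ ⊆ w j} ≤ r := (Fintype.card_subtype_le _).trans (by rw [Fintype.card_fin])
  have hXcard : Fintype.card X = r - ℓa := by
    show Fintype.card {i : Fin r // ¬ (a ∈ u i)} = r - ℓa
    rw [Fintype.card_subtype_compl, Fintype.card_fin]
  have hκcard : Fintype.card κ = 𝒜.card := by
    rw [← Fintype.card_coe 𝒜]
    refine Fintype.card_of_bijective (f := fun k : κ => (⟨u k.1.1, hκmem k⟩ : 𝒜)) ⟨fun k k' hkk => ?_, fun A => ?_⟩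
    · exact Subtype.ext (Subtype.ext (hu (congrArg Subtype.val hkk)))
    · obtain ⟨⟨i, hi⟩, haA⟩ := h𝒜 A.1 A.2
      refine ⟨⟨⟨i, by rw [hi]; exact haA⟩, fun hP => hP (by show u i ∈ 𝒜; rw [hi]; exact A.2)⟩, Subtype.ext hi⟩
  have hXsplit : Fintype.card X = n + Fintype.card κ := by
    rw [← Fintype.card_sum]
    exact Fintype.card_congr (Equiv.sumCompl Pk).symm
  have hYcard : Fintype.card {j : Fin r // ¬ ¬ (W₀ ⊆ w j)} = Fintype.card {j : Fin r // W₀ ⊆ w j} := by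
    rw [Fintype.card_subtype_compl, Fintype.card_subtype_compl, Fintype.card_fin]
    omega
  have hQcard : Fintype.card {j : Fin r // ¬ (W₀ ⊆ w j)} = n := by
    rw [Fintype.card_subtype_compl, Fintype.card_fin]
    omega
  have hn'le : ℓa ≤ Fintype.card {j : Fin r // ¬ ¬ (W₀ ⊆ w j)} := by rw [hYcard]; omega
  -- (3) columns: `q`-columns ≃ Fin n; link rows ≃ Fin ℓa; W₀-columns = kept (ℓa smallest faces) ⊕ κ
  let eQ : {j : Fin r // ¬ (W₀ ⊆ w j)} ≃ Fin n := Fintype.equivFinOfCardEq hQcard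
  let eP : {i : Fin r // a ∈ u i} ≃ Fin ℓa := Fintype.equivFinOfCardEq rfl
  let Y := {j : Fin r // ¬ ¬ (W₀ ⊆ w j)}
  have hYW : ∀ y : Y, W₀ ⊆ w y.1 := fun y => not_not.mp y.2
  obtain ⟨J₀, -, hJ₀card, hJ₀min⟩ := exists_subset_card_eq_minimal (Finset.univ : Finset Y) (fun y => (w y.1).card) ℓa
    (by rw [Finset.card_univ]; exact hn'le)
  let PJ : Y → Prop := fun y => y ∈ J₀
  have hJcard : Fintype.card {y : Y // PJ y} = ℓa := by
    show Fintype.card J₀ = ℓa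
    rw [Fintype.card_coe, hJ₀card]
  have hDcard : Fintype.card {y : Y // ¬ PJ y} = Fintype.card κ := by
    rw [Fintype.card_subtype_compl, hJcard, hκcard, hYcard]
    omega
  let eJ : {y : Y // PJ y} ≃ Fin ℓa := Fintype.equivFinOfCardEq hJcard
  let eD : {y : Y // ¬ PJ y} ≃ κ := Fintype.equivOfCardEq hDcard
  let e' : Y ≃ Fin ℓa ⊕ κ := (Equiv.sumCompl PJ).symm.trans (Equiv.sumCongr eJ eD)
  have he'_inl : ∀ y : Fin ℓa, e'.symm (Sum.inl y) = (eJ.symm y).1 := fun y => by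
    simp [e', Equiv.sumCongr_symm, Equiv.sumCongr_apply]
  -- (4) apply the core theorem
  refine symbolicDet_ne_zero_of_uqFaceCore (a := a) (c := c) (D := W₀.erase c) hs hu hw (Finset.notMem_erase c W₀) hFD hWs e eQ eP e'
    ?_ (fun k => ρ (u k.1.1)) ?_ ?_ ?_ ?_
  · -- up-set: no kept row contains a deleted face
    intro k x hsub
    rw [he_inr, he_inl] at hsub
    have hx := (eFin.symm x).2
    exact hx (hup _ (hκmem k) _ hsub (eFin.symm x).1.2)
  · -- roots
    intro k
    rw [he_inr]
    exact hρ _ (hκmem k)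
  · -- distinct roots
    intro k k' hkk
    have := hρinj (hκmem k) (hκmem k') hkk
    exact Subtype.ext (Subtype.ext (hu this))
  · -- (H1): the reduced deletion pair
    let u₀ : Fin n → Finset (Fin h) := fun x => u (e.symm (Sum.inl x)).1
    let w₀ : Fin n → Finset (Fin h) := fun y => w (eQ.symm y).1
    refine Hdel n u₀ w₀ ?_ ?_ ?_ ?_
    · intro x x' hxx
      exact Sum.inl_injective (e.symm.injective (Subtype.ext (hu hxx)))
    · intro y y' hyy
      exact eQ.symm.injective (Subtype.ext (hw hyy))
    · ext S
      constructor
      · rintro ⟨x, rfl⟩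
        refine ⟨⟨_, rfl⟩, (e.symm (Sum.inl x)).2, ?_⟩
        show u (e.symm (Sum.inl x)).1 ∉ 𝒜
        rw [he_inl]
        exact (eFin.symm x).2
      · rintro ⟨⟨i, rfl⟩, hai, hnot⟩
        refine ⟨eFin ⟨⟨i, hai⟩, hnot⟩, ?_⟩
        show u (e.symm (Sum.inl (eFin ⟨⟨i, hai⟩, hnot⟩))).1 = u i
        rw [he_inl, Equiv.symm_apply_apply]
    · ext T
      constructor
      · rintro ⟨y, rfl⟩
        exact ⟨⟨_, rfl⟩, (eQ.symm y).2⟩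
      · rintro ⟨⟨j, rfl⟩, hj⟩
        exact ⟨eQ ⟨j, hj⟩, by show w (eQ.symm (eQ ⟨j, hj⟩)).1 = w j; rw [Equiv.symm_apply_apply]⟩
  · -- (H2): the link pair against the kept link columns (a lower sub-pair)
    let u₁ : Fin ℓa → Finset (Fin h) := fun x => (u (eP.symm x).1).erase a
    let w₁ : Fin ℓa → Finset (Fin h) := fun y => w (e'.symm (Sum.inl y)).1 \ W₀
    have hw₁ : ∀ y, w₁ y = w (eJ.symm y).1.1 \ W₀ := fun y => by
      show w (e'.symm (Sum.inl y)).1 \ W₀ = _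
      rw [he'_inl]
    have herase_u : ∀ z z' : {i : Fin r // a ∈ u i}, (u z.1).erase a = (u z'.1).erase a → z = z' := by
      intro z z' hzz
      apply Subtype.ext; apply hu
      rw [← Finset.insert_erase z.2, ← Finset.insert_erase z'.2, hzz]
    refine Hlink ℓa u₁ w₁ ?_ ?_ ?_ ?_ ?_
    · intro x x' hxx
      exact eP.symm.injective (herase_u _ _ hxx)
    · intro y y' hyy
      rw [hw₁, hw₁] at hyy
      have h1 := Finset.sdiff_union_of_subset (hYW (eJ.symm y).1)
      have h2 := Finset.sdiff_union_of_subset (hYW (eJ.symm y').1)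
      have : w (eJ.symm y).1.1 = w (eJ.symm y').1.1 := by rw [← h1, ← h2, hyy]
      exact eJ.symm.injective (Subtype.ext (Subtype.ext (hw this)))
    · ext S
      constructor
      · rintro ⟨x, rfl⟩
        refine ⟨Finset.notMem_erase a _, ⟨(eP.symm x).1, ?_⟩⟩
        show u (eP.symm x).1 = insert a ((u (eP.symm x).1).erase a)
        rw [Finset.insert_erase (eP.symm x).2]
      · rintro ⟨haS, ⟨i, hi⟩⟩
        have hai : a ∈ u i := by rw [hi]; exact Finset.mem_insert_self a S
        refine ⟨eP ⟨i, hai⟩, ?_⟩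
        show (u (eP.symm (eP ⟨i, hai⟩)).1).erase a = S
        rw [Equiv.symm_apply_apply, hi, Finset.erase_insert haS]
    · rintro T ⟨y, rfl⟩
      rw [hw₁]
      refine ⟨Finset.sdiff_disjoint, ⟨(eJ.symm y).1.1, ?_⟩⟩
      rw [Finset.sdiff_union_of_subset (hYW _)]
    · -- lower: a face below a kept face through W₀ is again a kept face (minimality of the kept cardinalities)
      intro T T' hT'T hT
      obtain ⟨y, rfl⟩ := hT
      rw [hw₁] at hT'T
      have hj : W₀ ⊆ w (eJ.symm y).1.1 := hYW _
      have hdisj : Disjoint T' W₀ := Finset.disjoint_of_subset_left hT'T Finset.sdiff_disjoint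
      have hsub : T' ∪ W₀ ⊆ w (eJ.symm y).1.1 := by
        rw [← Finset.sdiff_union_of_subset hj]
        exact Finset.union_subset_union hT'T subset_rfl
      obtain ⟨j', hj'⟩ := hlw hsub ⟨(eJ.symm y).1.1, rfl⟩
      have hWj' : W₀ ⊆ w j' := by rw [hj']; exact Finset.subset_union_right
      let y' : Y := ⟨j', not_not.mpr hWj'⟩
      have hy'J : y' ∈ J₀ := by
        by_contra hy'
        have hle := hJ₀min (eJ.symm y).1 (eJ.symm y).2 y' (Finset.mem_univ _) hy'
        have hle' : (w j').card ≤ (w (eJ.symm y).1.1).card := by rw [hj']; exact Finset.card_le_card hsub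
        have heq : T' ∪ W₀ = w (eJ.symm y).1.1 :=
          Finset.eq_of_subset_of_card_le hsub (by rw [← hj']; exact hle)
        have hjj : j' = (eJ.symm y).1.1 := hw (by rw [hj', heq])
        exact hy' (by
          have : y' = (eJ.symm y).1 := Subtype.ext hjj
          rw [this]; exact (eJ.symm y).2)
      refine ⟨eJ ⟨y', hy'J⟩, ?_⟩
      show w₁ (eJ ⟨y', hy'J⟩) = T'
      rw [hw₁, Equiv.symm_apply_apply]
      show w j' \ W₀ = T'
      rw [hj', Finset.union_sdiff_cancel_right hdisj]

end

end Summit.ValiantsHypothesis.ValiantsHypothesis.Theorems.BarrierLever.AnchoredPeeling
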